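import Summits.ResolutionOfSingularities.ResolutionOfSingularities.Theorems.RisoStrataRisoCentresResolvePlumbing
import Summits.ResolutionOfSingularities.ResolutionOfSingularities.Theorems.RisoStrataRisoCentresResolvePersist
import Summits.ResolutionOfSingularities.ResolutionOfSingularities.Theorems.RisoStrataRisoCentresResolveRegNbhd
import Summits.ResolutionOfSingularities.ResolutionOfSingularities.Theorems.RisoStrataRisoCentresResolveRefine
import Summits.ResolutionOfSingularities.ResolutionOfSingularities.Theorems.RisoStrataRisoCentresResolvePathIndep
import Summits.ResolutionOfSingularities.ResolutionOfSingularities.Theorems.RisoStrataRisoCentresResolveTransfer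
import Summits.ResolutionOfSingularities.ResolutionOfSingularities.Theorems.RisoStrataRtdLocal
import Summits.ResolutionOfSingularities.ResolutionOfSingularities.Theses.RisoStrata
import Summits.ResolutionOfSingularities.ResolutionOfSingularities.Theorems.RisoStrataRisoCentresResolveNonvacuity

/-!
# Route RisoStrata — crux `RisoCentresResolve` (stmt-ResolutionOfSingularities-18546), line `Sketch`:
# the REDUCTION of the crux to its local-uniformization form (sorry-free)

`RisoCentresResolve` (Monreal, arXiv:2606.12554, Question 1.6 in characteristic `p`; ∃-schedule
form: ONE finite word of rtd-cut blow-ups resolving a projective presentation along EVERY valuation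
ring, every chart and every admissible choice of denominators) follows from its LOCAL form —
"some infinite word `w` of cut levels locally uniformizes every valuation ring `O ⊇ k` through the
canonical centres: an admissible chart path of the `w`-tower reaches a regular local ring at the
centre of `O` after finitely many steps" — by the transfer lemmas of line `Sketch`, all proved in the
tree: persistence (`stub_rcrPersist`), the Zariski–Riemann neighbourhood property (`stub_rcrRegNbhd`),
common refinement (`stub_rcrRefine`), path independence for a Zariski-local cut (`stub_rcrPathIndep`,
fed by the PROVED crux `RtdLocal`, `RtdLocal_of`), and Zariski's compactness of `Zar(K/k)`
(`stub_rcrTransfer`). This file records that reduction as one theorem,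
`risoCentresResolve_of_localUnif`, together with its converse (`localUnif_of_risoCentresResolve`:
admissible chart paths of every length exist along every valuation ring — the centre ideal always
contains a nonzero element by generic regularity and openness of the regular locus, and a generator
of minimal value is an admissible denominator — so a resolving schedule is a uniformizing word), i.e.
the EQUIVALENCE `risoCentresResolve_iff_localUnif`. The local form itself is the open core of the
line (`stub_rcrLocalUnif` in `Cruxes/RisoCentresResolve/Lines/Sketch.lean`). The constant top word
is NOT a uniformizing word from dimension 4 on (`Cruxes/RisoCentresResolve/ConstantTopWordDead.md`).
-/

noncomputable section

set_option linter.dupNamespace false -- mandated namespace of this single-conjunct summit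

namespace Summit.ResolutionOfSingularities.ResolutionOfSingularities.Theorems

open Summit.ResolutionOfSingularities.ResolutionOfSingularities.Theses.RisoStrata
open Literature.AlgebraicGeometry.Resolution

/-! ## The reduction and its converse -/

/-- The rtd-cut predicate `P B m d := ¬ Rtd B m (d+1)` of route RisoStrata (let-expanded) is
Zariski-local, by the proved crux `RtdLocal` (`RtdLocal_of`). [folklore] -/
theorem reduction_risoLocal_cut (p : ℕ) (hp : p.Prime) (k : Type) [Field k] [CharP k p]
    [IsAlgClosed k] (K : Type) [Field K] [Algebra k K] :
    RisoLocal (fun (B : Subalgebra k K) (m : Ideal ↥B) (d : ℕ) => ¬ ∃ (n : ℕ) (g : Fin n → ↥B),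
        (∀ i, g i ∈ m) ∧ Algebra.adjoin k (Set.range fun i => (g i : K)) = B ∧
        ∃ W : Submodule k (Fin n → k), d + 1 ≤ Module.finrank k ↥W ∧
        ∃ φ : {α : ↥B →ₐ[k] HahnSeries ℚ k // ∀ b ∈ m, 0 < (α b).orderTop} → (Fin n → HahnSeries ℚ k),
          (∀ a b : {α : ↥B →ₐ[k] HahnSeries ℚ k // ∀ b ∈ m, 0 < (α b).orderTop}, a ≠ b →
            ∃ j, ∀ i, (a.1 (g j) - b.1 (g j)).orderTop <
              ((φ a i - φ b i) - (a.1 (g i) - b.1 (g i))).orderTop) ∧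
          (∀ a i, 0 < (φ a i).orderTop) ∧
          (∀ a, ∀ w : Fin n → HahnSeries ℚ k, (∀ i, 0 < (w i).orderTop) →
            w ∈ Submodule.span (HahnSeries ℚ k)
              ((fun u : Fin n → k => fun i => HahnSeries.C (u i)) '' (W : Set (Fin n → k))) →
              ∃ b, φ b = φ a + w)) := by
  intro B s hs hs0 hB m' hm' d
  have h1 := RtdLocal_of p hp k K B s hs hs0 hB m' hm' (d + 1)
  exact not_congr h1

/-- Reading a prefix word: `((List.range T).map w).getD s 0 = w s` for `s < T`. [folklore] -/
theorem reduction_getD_map_range (w : ℕ → ℕ) {T s : ℕ} (hs : s < T) :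
    ((List.range T).map w).getD s 0 = w s := by
  rw [List.getD_eq_getElem?_getD, List.getElem?_map, List.getElem?_range hs, Option.map_some,
    Option.getD_some]

/-- **`RisoCentresResolve` reduces to riso local uniformization along some word** (line `Sketch`
of crux stmt-ResolutionOfSingularities-18546, sorry-free composition). Hypothesis `hLU`: for every
prime `p`, algebraically closed `k` of characteristic `p` and projective presentation
`K = k(hᵢ/hⱼ)`, there is `w : ℕ → ℕ` such that every valuation ring `O ⊇ k` of `K` admits a chart
`k[hᵢ/hⱼ] ⊆ O` and an admissible chart path of the `w`-tower (centres = closures of the rtd-cuts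
`Z_(w t)` of the singular locus, denominators of minimal value) whose local ring at the centre of
`O` is regular after some `t` steps. Conclusion: the route decl `RisoCentresResolve`. Proof: for a
presentation take `w` from `hLU`; persistence, path independence (common refinement + locality of
the cut from `RtdLocal_of`) and the neighbourhood property feed the Zariski–Riemann transfer
`stub_rcrTransfer`, which returns one length `T`; the schedule is the prefix `w|T`. [folklore] -/
theorem risoCentresResolve_of_localUnif
    (hLU : ∀ p : ℕ, p.Prime → ∀ (k : Type) [Field k] [CharP k p] [IsAlgClosed k]
    (K : Type) [Field K] [Algebra k K] (N : ℕ) (h : Fin (N + 1) → K), (∀ i, h i ≠ 0) →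
    IntermediateField.adjoin k
      (Set.range fun ij : Fin (N + 1) × Fin (N + 1) => h ij.1 * (h ij.2)⁻¹) = ⊤ →
    ∃ w : ℕ → ℕ, ∀ O : ValuationSubring K, (∀ c : k, algebraMap k K c ∈ O) →
      ∃ (j : Fin (N + 1)) (x : ℕ → K) (t : ℕ), (∀ i, h i * (h j)⁻¹ ∈ O) ∧
        (∀ s, s < t → risoValid (fun (B : Subalgebra k K) (m : Ideal ↥B) (d : ℕ) => ¬ ∃ (n : ℕ) (g : Fin n → ↥B),
        (∀ i, g i ∈ m) ∧ Algebra.adjoin k (Set.range fun i => (g i : K)) = B ∧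
        ∃ W : Submodule k (Fin n → k), d + 1 ≤ Module.finrank k ↥W ∧
        ∃ φ : {α : ↥B →ₐ[k] HahnSeries ℚ k // ∀ b ∈ m, 0 < (α b).orderTop} → (Fin n → HahnSeries ℚ k),
          (∀ a b : {α : ↥B →ₐ[k] HahnSeries ℚ k // ∀ b ∈ m, 0 < (α b).orderTop}, a ≠ b →
            ∃ j, ∀ i, (a.1 (g j) - b.1 (g j)).orderTop <
              ((φ a i - φ b i) - (a.1 (g i) - b.1 (g i))).orderTop) ∧
          (∀ a i, 0 < (φ a i).orderTop) ∧
          (∀ a, ∀ w : Fin n → HahnSeries ℚ k, (∀ i, 0 < (w i).orderTop) →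
            w ∈ Submodule.span (HahnSeries ℚ k)
              ((fun u : Fin n → k => fun i => HahnSeries.C (u i)) '' (W : Set (Fin n → k))) →
              ∃ b, φ b = φ a + w)) O
          (risoStage (fun (B : Subalgebra k K) (m : Ideal ↥B) (d : ℕ) => ¬ ∃ (n : ℕ) (g : Fin n → ↥B),
        (∀ i, g i ∈ m) ∧ Algebra.adjoin k (Set.range fun i => (g i : K)) = B ∧
        ∃ W : Submodule k (Fin n → k), d + 1 ≤ Module.finrank k ↥W ∧
        ∃ φ : {α : ↥B →ₐ[k] HahnSeries ℚ k // ∀ b ∈ m, 0 < (α b).orderTop} → (Fin n → HahnSeries ℚ k),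
          (∀ a b : {α : ↥B →ₐ[k] HahnSeries ℚ k // ∀ b ∈ m, 0 < (α b).orderTop}, a ≠ b →
            ∃ j, ∀ i, (a.1 (g j) - b.1 (g j)).orderTop <
              ((φ a i - φ b i) - (a.1 (g i) - b.1 (g i))).orderTop) ∧
          (∀ a i, 0 < (φ a i).orderTop) ∧
          (∀ a, ∀ w : Fin n → HahnSeries ℚ k, (∀ i, 0 < (w i).orderTop) →
            w ∈ Submodule.span (HahnSeries ℚ k)
              ((fun u : Fin n → k => fun i => HahnSeries.C (u i)) '' (W : Set (Fin n → k))) →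
              ∃ b, φ b = φ a + w)) (Algebra.adjoin k (Set.range fun i => h i * (h j)⁻¹))
            ((List.range t).map w) x s) (w s) (x s)) ∧
        IsRegularLocalRing ↥(risoLoc O
          (risoStage (fun (B : Subalgebra k K) (m : Ideal ↥B) (d : ℕ) => ¬ ∃ (n : ℕ) (g : Fin n → ↥B),
        (∀ i, g i ∈ m) ∧ Algebra.adjoin k (Set.range fun i => (g i : K)) = B ∧
        ∃ W : Submodule k (Fin n → k), d + 1 ≤ Module.finrank k ↥W ∧
        ∃ φ : {α : ↥B →ₐ[k] HahnSeries ℚ k // ∀ b ∈ m, 0 < (α b).orderTop} → (Fin n → HahnSeries ℚ k),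
          (∀ a b : {α : ↥B →ₐ[k] HahnSeries ℚ k // ∀ b ∈ m, 0 < (α b).orderTop}, a ≠ b →
            ∃ j, ∀ i, (a.1 (g j) - b.1 (g j)).orderTop <
              ((φ a i - φ b i) - (a.1 (g i) - b.1 (g i))).orderTop) ∧
          (∀ a i, 0 < (φ a i).orderTop) ∧
          (∀ a, ∀ w : Fin n → HahnSeries ℚ k, (∀ i, 0 < (w i).orderTop) →
            w ∈ Submodule.span (HahnSeries ℚ k)
              ((fun u : Fin n → k => fun i => HahnSeries.C (u i)) '' (W : Set (Fin n → k))) →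
              ∃ b, φ b = φ a + w)) (Algebra.adjoin k (Set.range fun i => h i * (h j)⁻¹))
            ((List.range t).map w) x t))) :
    RisoCentresResolve := by
  intro p hp k _ _ _ K _ _ N h hh hgen
  show RisoSchedule (fun (B : Subalgebra k K) (m : Ideal ↥B) (d : ℕ) => ¬ ∃ (n : ℕ) (g : Fin n → ↥B),
        (∀ i, g i ∈ m) ∧ Algebra.adjoin k (Set.range fun i => (g i : K)) = B ∧
        ∃ W : Submodule k (Fin n → k), d + 1 ≤ Module.finrank k ↥W ∧
        ∃ φ : {α : ↥B →ₐ[k] HahnSeries ℚ k // ∀ b ∈ m, 0 < (α b).orderTop} → (Fin n → HahnSeries ℚ k),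
          (∀ a b : {α : ↥B →ₐ[k] HahnSeries ℚ k // ∀ b ∈ m, 0 < (α b).orderTop}, a ≠ b →
            ∃ j, ∀ i, (a.1 (g j) - b.1 (g j)).orderTop <
              ((φ a i - φ b i) - (a.1 (g i) - b.1 (g i))).orderTop) ∧
          (∀ a i, 0 < (φ a i).orderTop) ∧
          (∀ a, ∀ w : Fin n → HahnSeries ℚ k, (∀ i, 0 < (w i).orderTop) →
            w ∈ Submodule.span (HahnSeries ℚ k)
              ((fun u : Fin n → k => fun i => HahnSeries.C (u i)) '' (W : Set (Fin n → k))) →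
              ∃ b, φ b = φ a + w)) N h
  obtain ⟨w, hw⟩ := hLU p hp k K N h hh hgen
  have hLoc := reduction_risoLocal_cut p hp k K
  obtain ⟨T, hT⟩ := stub_rcrTransfer _ N h hh w
    (fun O B hB hBO d xt hV hreg => stub_rcrPersist _ O B hB hBO d xt hV hreg)
    (fun O B B' hB hB' hBO hB'O hloc d xt xt' hV hV' =>
      stub_rcrPathIndep _ hLoc O B B' hB hB' hBO hB'O hloc
        (stub_rcrRefine O B B' hB hB' hBO hB'O hloc) d xt xt' hV hV')
    (fun O B hB hBO hreg => stub_rcrRegNbhd O B hB hBO hreg) hw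
  refine ⟨(List.range T).map w, fun O hk j hj x hadm => ?_⟩
  have hlen : ((List.range T).map w).length = T := by simp
  rw [hlen]
  refine hT O hk j hj x fun s hs => ?_
  have := hadm s (by rw [hlen]; exact hs)
  rwa [reduction_getD_map_range w hs] at this


/-- **Converse: a resolving schedule is a uniformizing word.** If `RisoCentresResolve` holds then so
does its local-uniformization form: take `w s := sched[s]` (padded by `0`), the chart `k[hᵢ/hⱼ]` with
`ν(hⱼ)` minimal, an admissible chart path of length `|sched|` (`rcr_exists_admissible`), and read
off regularity at stage `|sched|`. [folklore] -/
theorem localUnif_of_risoCentresResolve (hR : RisoCentresResolve) :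
    ∀ p : ℕ, p.Prime → ∀ (k : Type) [Field k] [CharP k p] [IsAlgClosed k]
    (K : Type) [Field K] [Algebra k K] (N : ℕ) (h : Fin (N + 1) → K), (∀ i, h i ≠ 0) →
    IntermediateField.adjoin k
      (Set.range fun ij : Fin (N + 1) × Fin (N + 1) => h ij.1 * (h ij.2)⁻¹) = ⊤ →
    ∃ w : ℕ → ℕ, ∀ O : ValuationSubring K, (∀ c : k, algebraMap k K c ∈ O) →
      ∃ (j : Fin (N + 1)) (x : ℕ → K) (t : ℕ), (∀ i, h i * (h j)⁻¹ ∈ O) ∧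
        (∀ s, s < t → risoValid (fun (B : Subalgebra k K) (m : Ideal ↥B) (d : ℕ) => ¬ ∃ (n : ℕ) (g : Fin n → ↥B),
        (∀ i, g i ∈ m) ∧ Algebra.adjoin k (Set.range fun i => (g i : K)) = B ∧
        ∃ W : Submodule k (Fin n → k), d + 1 ≤ Module.finrank k ↥W ∧
        ∃ φ : {α : ↥B →ₐ[k] HahnSeries ℚ k // ∀ b ∈ m, 0 < (α b).orderTop} → (Fin n → HahnSeries ℚ k),
          (∀ a b : {α : ↥B →ₐ[k] HahnSeries ℚ k // ∀ b ∈ m, 0 < (α b).orderTop}, a ≠ b →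
            ∃ j, ∀ i, (a.1 (g j) - b.1 (g j)).orderTop <
              ((φ a i - φ b i) - (a.1 (g i) - b.1 (g i))).orderTop) ∧
          (∀ a i, 0 < (φ a i).orderTop) ∧
          (∀ a, ∀ w : Fin n → HahnSeries ℚ k, (∀ i, 0 < (w i).orderTop) →
            w ∈ Submodule.span (HahnSeries ℚ k)
              ((fun u : Fin n → k => fun i => HahnSeries.C (u i)) '' (W : Set (Fin n → k))) →
              ∃ b, φ b = φ a + w)) O
          (risoStage (fun (B : Subalgebra k K) (m : Ideal ↥B) (d : ℕ) => ¬ ∃ (n : ℕ) (g : Fin n → ↥B),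
        (∀ i, g i ∈ m) ∧ Algebra.adjoin k (Set.range fun i => (g i : K)) = B ∧
        ∃ W : Submodule k (Fin n → k), d + 1 ≤ Module.finrank k ↥W ∧
        ∃ φ : {α : ↥B →ₐ[k] HahnSeries ℚ k // ∀ b ∈ m, 0 < (α b).orderTop} → (Fin n → HahnSeries ℚ k),
          (∀ a b : {α : ↥B →ₐ[k] HahnSeries ℚ k // ∀ b ∈ m, 0 < (α b).orderTop}, a ≠ b →
            ∃ j, ∀ i, (a.1 (g j) - b.1 (g j)).orderTop <
              ((φ a i - φ b i) - (a.1 (g i) - b.1 (g i))).orderTop) ∧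
          (∀ a i, 0 < (φ a i).orderTop) ∧
          (∀ a, ∀ w : Fin n → HahnSeries ℚ k, (∀ i, 0 < (w i).orderTop) →
            w ∈ Submodule.span (HahnSeries ℚ k)
              ((fun u : Fin n → k => fun i => HahnSeries.C (u i)) '' (W : Set (Fin n → k))) →
              ∃ b, φ b = φ a + w)) (Algebra.adjoin k (Set.range fun i => h i * (h j)⁻¹))
            ((List.range t).map w) x s) (w s) (x s)) ∧
        IsRegularLocalRing ↥(risoLoc O
          (risoStage (fun (B : Subalgebra k K) (m : Ideal ↥B) (d : ℕ) => ¬ ∃ (n : ℕ) (g : Fin n → ↥B),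
        (∀ i, g i ∈ m) ∧ Algebra.adjoin k (Set.range fun i => (g i : K)) = B ∧
        ∃ W : Submodule k (Fin n → k), d + 1 ≤ Module.finrank k ↥W ∧
        ∃ φ : {α : ↥B →ₐ[k] HahnSeries ℚ k // ∀ b ∈ m, 0 < (α b).orderTop} → (Fin n → HahnSeries ℚ k),
          (∀ a b : {α : ↥B →ₐ[k] HahnSeries ℚ k // ∀ b ∈ m, 0 < (α b).orderTop}, a ≠ b →
            ∃ j, ∀ i, (a.1 (g j) - b.1 (g j)).orderTop <
              ((φ a i - φ b i) - (a.1 (g i) - b.1 (g i))).orderTop) ∧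
          (∀ a i, 0 < (φ a i).orderTop) ∧
          (∀ a, ∀ w : Fin n → HahnSeries ℚ k, (∀ i, 0 < (w i).orderTop) →
            w ∈ Submodule.span (HahnSeries ℚ k)
              ((fun u : Fin n → k => fun i => HahnSeries.C (u i)) '' (W : Set (Fin n → k))) →
              ∃ b, φ b = φ a + w)) (Algebra.adjoin k (Set.range fun i => h i * (h j)⁻¹))
            ((List.range t).map w) x t)) := by
  classical
  intro p hp k _ _ _ K _ _ N h hh hgen
  have hs : RisoSchedule (fun (B : Subalgebra k K) (m : Ideal ↥B) (d : ℕ) => ¬ ∃ (n : ℕ) (g : Fin n → ↥B),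
        (∀ i, g i ∈ m) ∧ Algebra.adjoin k (Set.range fun i => (g i : K)) = B ∧
        ∃ W : Submodule k (Fin n → k), d + 1 ≤ Module.finrank k ↥W ∧
        ∃ φ : {α : ↥B →ₐ[k] HahnSeries ℚ k // ∀ b ∈ m, 0 < (α b).orderTop} → (Fin n → HahnSeries ℚ k),
          (∀ a b : {α : ↥B →ₐ[k] HahnSeries ℚ k // ∀ b ∈ m, 0 < (α b).orderTop}, a ≠ b →
            ∃ j, ∀ i, (a.1 (g j) - b.1 (g j)).orderTop <
              ((φ a i - φ b i) - (a.1 (g i) - b.1 (g i))).orderTop) ∧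
          (∀ a i, 0 < (φ a i).orderTop) ∧
          (∀ a, ∀ w : Fin n → HahnSeries ℚ k, (∀ i, 0 < (w i).orderTop) →
            w ∈ Submodule.span (HahnSeries ℚ k)
              ((fun u : Fin n → k => fun i => HahnSeries.C (u i)) '' (W : Set (Fin n → k))) →
              ∃ b, φ b = φ a + w)) N h := hR p hp k K N h hh hgen
  obtain ⟨sched, hsched⟩ := hs
  refine ⟨fun s => sched.getD s 0, fun O hk => ?_⟩
  -- the chart: `j` with `ν(h j)` minimal
  obtain ⟨j, -, -, hmax⟩ :=
    exists_max_valuation O Finset.univ h ⟨0, Finset.mem_univ _, hh 0⟩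
  have hv0 : O.valuation (h j) ≠ 0 := by simpa using hh j
  have hj : ∀ i, h i * (h j)⁻¹ ∈ O := fun i => by
    rw [← O.valuation_le_one_iff, map_mul, map_inv₀]
    calc O.valuation (h i) * (O.valuation (h j))⁻¹
        ≤ O.valuation (h j) * (O.valuation (h j))⁻¹ := by
          gcongr
          exact hmax i (Finset.mem_univ i)
      _ = 1 := mul_inv_cancel₀ hv0
  have hB₀ : (Algebra.adjoin k (Set.range fun i => h i * (h j)⁻¹)).FG := by
    refine ⟨Finset.univ.image fun i => h i * (h j)⁻¹, ?_⟩
    rw [Finset.coe_image, Finset.coe_univ, Set.image_univ]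
  have hB₀O := chart_toSubring_le hk h j hj
  obtain ⟨x, hx⟩ := rcr_exists_admissible (fun (B : Subalgebra k K) (m : Ideal ↥B) (d : ℕ) => ¬ ∃ (n : ℕ) (g : Fin n → ↥B),
        (∀ i, g i ∈ m) ∧ Algebra.adjoin k (Set.range fun i => (g i : K)) = B ∧
        ∃ W : Submodule k (Fin n → k), d + 1 ≤ Module.finrank k ↥W ∧
        ∃ φ : {α : ↥B →ₐ[k] HahnSeries ℚ k // ∀ b ∈ m, 0 < (α b).orderTop} → (Fin n → HahnSeries ℚ k),
          (∀ a b : {α : ↥B →ₐ[k] HahnSeries ℚ k // ∀ b ∈ m, 0 < (α b).orderTop}, a ≠ b →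
            ∃ j, ∀ i, (a.1 (g j) - b.1 (g j)).orderTop <
              ((φ a i - φ b i) - (a.1 (g i) - b.1 (g i))).orderTop) ∧
          (∀ a i, 0 < (φ a i).orderTop) ∧
          (∀ a, ∀ w : Fin n → HahnSeries ℚ k, (∀ i, 0 < (w i).orderTop) →
            w ∈ Submodule.span (HahnSeries ℚ k)
              ((fun u : Fin n → k => fun i => HahnSeries.C (u i)) '' (W : Set (Fin n → k))) →
              ∃ b, φ b = φ a + w)) O _ hB₀ hB₀O sched sched.length
  have hw : (List.range sched.length).map (fun s => sched.getD s 0) = sched := by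
    apply List.ext_getElem
    · simp
    · intro n h1 h2
      rw [List.getElem_map, List.getElem_range, List.getD_eq_getElem?_getD,
        List.getElem?_eq_getElem h2, Option.getD_some]
  refine ⟨j, x, sched.length, hj, fun s hs => ?_, ?_⟩
  · rw [hw]
    exact hx s hs hs
  · rw [hw]
    exact hsched O hk j hj x fun t ht => hx t ht ht

/-- **`RisoCentresResolve` is EQUIVALENT to riso local uniformization along some word** (the
crux of route RisoStrata, stmt-ResolutionOfSingularities-18546, equals the open core
`stub_rcrLocalUnif` of its line `Sketch`; everything else in the line is proved). [folklore] -/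
theorem risoCentresResolve_iff_localUnif :
    RisoCentresResolve ↔ (∀ p : ℕ, p.Prime → ∀ (k : Type) [Field k] [CharP k p] [IsAlgClosed k]
    (K : Type) [Field K] [Algebra k K] (N : ℕ) (h : Fin (N + 1) → K), (∀ i, h i ≠ 0) →
    IntermediateField.adjoin k
      (Set.range fun ij : Fin (N + 1) × Fin (N + 1) => h ij.1 * (h ij.2)⁻¹) = ⊤ →
    ∃ w : ℕ → ℕ, ∀ O : ValuationSubring K, (∀ c : k, algebraMap k K c ∈ O) →
      ∃ (j : Fin (N + 1)) (x : ℕ → K) (t : ℕ), (∀ i, h i * (h j)⁻¹ ∈ O) ∧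
        (∀ s, s < t → risoValid (fun (B : Subalgebra k K) (m : Ideal ↥B) (d : ℕ) => ¬ ∃ (n : ℕ) (g : Fin n → ↥B),
        (∀ i, g i ∈ m) ∧ Algebra.adjoin k (Set.range fun i => (g i : K)) = B ∧
        ∃ W : Submodule k (Fin n → k), d + 1 ≤ Module.finrank k ↥W ∧
        ∃ φ : {α : ↥B →ₐ[k] HahnSeries ℚ k // ∀ b ∈ m, 0 < (α b).orderTop} → (Fin n → HahnSeries ℚ k),
          (∀ a b : {α : ↥B →ₐ[k] HahnSeries ℚ k // ∀ b ∈ m, 0 < (α b).orderTop}, a ≠ b →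
            ∃ j, ∀ i, (a.1 (g j) - b.1 (g j)).orderTop <
              ((φ a i - φ b i) - (a.1 (g i) - b.1 (g i))).orderTop) ∧
          (∀ a i, 0 < (φ a i).orderTop) ∧
          (∀ a, ∀ w : Fin n → HahnSeries ℚ k, (∀ i, 0 < (w i).orderTop) →
            w ∈ Submodule.span (HahnSeries ℚ k)
              ((fun u : Fin n → k => fun i => HahnSeries.C (u i)) '' (W : Set (Fin n → k))) →
              ∃ b, φ b = φ a + w)) O
          (risoStage (fun (B : Subalgebra k K) (m : Ideal ↥B) (d : ℕ) => ¬ ∃ (n : ℕ) (g : Fin n → ↥B),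
        (∀ i, g i ∈ m) ∧ Algebra.adjoin k (Set.range fun i => (g i : K)) = B ∧
        ∃ W : Submodule k (Fin n → k), d + 1 ≤ Module.finrank k ↥W ∧
        ∃ φ : {α : ↥B →ₐ[k] HahnSeries ℚ k // ∀ b ∈ m, 0 < (α b).orderTop} → (Fin n → HahnSeries ℚ k),
          (∀ a b : {α : ↥B →ₐ[k] HahnSeries ℚ k // ∀ b ∈ m, 0 < (α b).orderTop}, a ≠ b →
            ∃ j, ∀ i, (a.1 (g j) - b.1 (g j)).orderTop <
              ((φ a i - φ b i) - (a.1 (g i) - b.1 (g i))).orderTop) ∧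
          (∀ a i, 0 < (φ a i).orderTop) ∧
          (∀ a, ∀ w : Fin n → HahnSeries ℚ k, (∀ i, 0 < (w i).orderTop) →
            w ∈ Submodule.span (HahnSeries ℚ k)
              ((fun u : Fin n → k => fun i => HahnSeries.C (u i)) '' (W : Set (Fin n → k))) →
              ∃ b, φ b = φ a + w)) (Algebra.adjoin k (Set.range fun i => h i * (h j)⁻¹))
            ((List.range t).map w) x s) (w s) (x s)) ∧
        IsRegularLocalRing ↥(risoLoc O
          (risoStage (fun (B : Subalgebra k K) (m : Ideal ↥B) (d : ℕ) => ¬ ∃ (n : ℕ) (g : Fin n → ↥B),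
        (∀ i, g i ∈ m) ∧ Algebra.adjoin k (Set.range fun i => (g i : K)) = B ∧
        ∃ W : Submodule k (Fin n → k), d + 1 ≤ Module.finrank k ↥W ∧
        ∃ φ : {α : ↥B →ₐ[k] HahnSeries ℚ k // ∀ b ∈ m, 0 < (α b).orderTop} → (Fin n → HahnSeries ℚ k),
          (∀ a b : {α : ↥B →ₐ[k] HahnSeries ℚ k // ∀ b ∈ m, 0 < (α b).orderTop}, a ≠ b →
            ∃ j, ∀ i, (a.1 (g j) - b.1 (g j)).orderTop <
              ((φ a i - φ b i) - (a.1 (g i) - b.1 (g i))).orderTop) ∧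
          (∀ a i, 0 < (φ a i).orderTop) ∧
          (∀ a, ∀ w : Fin n → HahnSeries ℚ k, (∀ i, 0 < (w i).orderTop) →
            w ∈ Submodule.span (HahnSeries ℚ k)
              ((fun u : Fin n → k => fun i => HahnSeries.C (u i)) '' (W : Set (Fin n → k))) →
              ∃ b, φ b = φ a + w)) (Algebra.adjoin k (Set.range fun i => h i * (h j)⁻¹))
            ((List.range t).map w) x t))) :=
  ⟨localUnif_of_risoCentresResolve, risoCentresResolve_of_localUnif⟩

end Summit.ResolutionOfSingularities.ResolutionOfSingularities.Theorems

end
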